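import Literature.AlgebraicGeometry.Motives.JacobianGaloisCoverNormAdjoint
import HarnessLib

/-!
# The canonical theta pairing of a Jacobian is transported along isomorphisms of curves, and does not depend on the
# theta divisor (consequences of the named fact `Jacobian.galoisCover_pullback_isWeilPairingAdjoint_norm` at `Δ = 1`)

Layer `Literature/AlgebraicGeometry/Motives`, namespace `Literature.AlgebraicGeometry.Motives` (dot notation on the tree's
Albanese-characterised `Motives.Jacobian C`).  KERNEL ONLY: theorems; no definition, no named fact, no instance, no `sorry`.
Every theorem takes the named fact `(hFP2 : Jacobian.galoisCover_pullback_isWeilPairingAdjoint_norm)`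
(`Motives/JacobianGaloisCoverNormAdjoint`, [LangeRodriguez2022] (3.3) + Prop. 3.5.1, [Lange2023AbelianVarietiesComplex] (4.9))
as an explicit HYPOTHESIS and reads it at the trivial group `Δ = 1`:

for an ISOMORPHISM `e : X ≅ Y` of smooth projective geometrically irreducible complex curves, Jacobians `𝒥X`, `𝒥Y`
(`dim J_Y ≥ 1`) and ANY two Riemann theta divisors `Θ_X`, `Θ_Y` defining the canonical PRINCIPAL polarisations,

* §0 `isSepQuotient_of_forall_eq_refl_of_isIso` — an isomorphism is a separated quotient by the trivial action (the
  `IsSepQuotient` binder of the fact at `Δ = 1`), and the Galois pin `Nm_e ≫ t = Σ_{δ ∈ 1} δ_* = 𝟙` forces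
  `t = Nm_{e⁻¹}` (`pushforward_comp_pushforward_inv`);
* §1 **`Jacobian.weilPairingLevel_pushforward_inv_eq`** — `ē_N^{Θ_X}(Nm_{e⁻¹} P, Q) = ē_N^{Θ_Y}(P, Nm_e Q)`:
  «`Nm_{e⁻¹} = Nm_e⁻¹` is the `ē_N`-adjoint of `Nm_e`» (the fact at `Δ := PUnit`, `act := 1`, `p := e.hom`, `t := Nm_{e⁻¹}`);
* §2 **`Jacobian.weilPairingLevel_pushforward_iso_eq`** — `ē_N^{Θ_Y}(Nm_e P, Nm_e Q) = ē_N^{Θ_X}(P, Q)`: the induced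
  isomorphism `Nm_e : J_X ⥲ J_Y` is an isomorphism of PRINCIPALLY POLARISED abelian varieties at every level, whichever
  theta divisors represent the two canonical polarisations; pull-back form `ē_N^{(Nm_e)^*Θ_Y} = ē_N^{Θ_X}`
  (`weilPairingLevel_pullback_pushforward_iso_eq`, ★ `AbelianVariety.weilPairingLevel_pullback`);
* §3 **`Jacobian.weilPairingLevel_eq_of_isRiemannThetaDivisor`** — (Θ-uniq) `ē_N^{Θ}(P, Q) = ē_N^{Θ′}(P, Q)` for two
  principal Riemann theta divisors `Θ`, `Θ′` of ONE Jacobian: the canonical polarisation is well defined whichever theta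
  divisor represents it ([Lange2023AbelianVarietiesComplex] §4.1.2 Prop. 4.1.2, Cor. 4.2.4 — the DISCLOSED `p = 𝟙`
  content of the fact, see its docstring «Faithfulness»);
* §4 `Jacobian.weilPairingLevel_uniqueUpToIso_eq` — two Jacobian STRUCTURES `𝒥₁`, `𝒥₂` of one curve: the canonical
  isomorphism `uniqueUpToIso 𝒥₁ 𝒥₂` (★ `pushforward_id_eq_uniqueUpToIso_hom`) matches the canonical theta pairings.

Proofs: specialisation of the fact plus ★ `Jacobian.pushforward_id` / `pushforward_comp` /
`pushforward_id_eq_uniqueUpToIso_hom` (`Motives/Jacobian`) and ★ `AbelianVariety.weilPairingLevel_pullback`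
(`Motives/AbelianVarietyWeilPairingPullback`); nothing analytic.  The dominance of `[N]` on the Jacobians (needed to FORM
`weilPairingLevel`) is carried as instance binders exactly as in the fact (★ `AbelianVariety.isIsogeny_zsmul_id_holds`
discharges them for `N ≥ 1`).

Use (cell `hodgecm-mathlib`, D-0151, crux HLiu418 = stmt-HodgeConjecture-24832, d6 line, socket `SocketRosH` /
`stub_RosH` glue, piece (L) «level adjoints on `Y = ⊞_c J(E′_c)`»): the push–pull words of the Hecke operators on the
complex Albanese are built from norms `Nm_p` of Galois piece covers (adjoint `p^*` = the fact itself), their adjoints,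
and `Nm_T = Alb(T)` for ISOMORPHISMS `T` between pieces — §1/§2 give the adjoint `Nm_{T⁻¹}` of the latter with NO
«`T^*Θ ∼ Θ`» lemma and for independently chosen theta divisors on the pieces (A-plan2 (g12) census point (c-i),
A-p18 (g11) `levelAdjoint_fan_entry`).  HC_CM is proved only modulo the 7 printed citations until rung 0 closes; this
file is conditional on the named fact it takes as a hypothesis and moves no book by itself.

## References
* [LangeRodriguez2022] H. Lange, R. E. Rodríguez, *Decomposition of Jacobians by Prym Varieties*, LNM 2310 (2022),
  §3.2.1 eq. (3.3) (pp. 46–47), §3.5.1 Prop. 3.5.1 (p. 65).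
* [Lange2023AbelianVarietiesComplex] H. Lange, *Abelian Varieties over the Complex Numbers* (2023), §4.1.2 Prop. 4.1.2,
  §4.2.1 Cor. 4.2.4, §4.5.2 eq. (4.9).
* [Milne1986JacobianVarieties] J. S. Milne, *Jacobian Varieties*, in Cornell–Silverman (1986), §6 Prop. 6.4 (Albanese
  functoriality `N_f`), Remark 6.5 (two Jacobians are uniquely isomorphic), Thm. 6.6.
* [MumfordAV1970] D. Mumford, *Abelian Varieties* (1970), §20 property (3) of `e_n` (p. 186); §7 Thm. p. 66 (Remark).
-/

noncomputable section

open CategoryTheory AlgebraicGeometry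

namespace Literature.AlgebraicGeometry.Motives

universe u v

/-! ### §0 The binders of the fact at the trivial group -/

/-- An ISOMORPHISM `p : Y ⟶ Z` of `k`-schemes is a separated quotient of `Y` by any family of TRIVIAL automorphisms
(`act g = 𝟙` for all `g`): invariance is `𝟙 ≫ p = p`, and an (automatically invariant) `f : Y ⟶ W` factors uniquely as
`f = p ≫ (p⁻¹ ≫ f)`.  The case `Δ = 1` of Mumford's categorical quotient. [cite: MumfordAV1970, §7 Thm. p. 66 (Remark)] -/
theorem isSepQuotient_of_forall_eq_refl_of_isIso {k : Type u} [Field k] {Δ : Type v} {Y Z : SchemeOver k}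
    (act : Δ → (Y ≅ Y)) (hact : ∀ g, act g = Iso.refl Y) (p : Y ⟶ Z) [IsIso p] : IsSepQuotient act p := by
  refine ⟨fun g => by rw [hact g, Iso.refl_hom, Category.id_comp], fun W f _ _ => ?_⟩
  refine ⟨inv p ≫ f, ?_, fun g hg => ?_⟩
  · show p ≫ (inv p ≫ f) = f
    rw [IsIso.hom_inv_id_assoc]
  · show g = inv p ≫ f
    rw [← hg, IsIso.inv_hom_id_assoc]

/-- The trivial homomorphism `1 : PUnit →* Aut X` takes the value `Iso.refl X`. [folklore] -/
private theorem monoidHom_one_punit_apply_eq_refl {C : Type u} [Category.{v} C] (X : C) (g : PUnit.{v + 1}) :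
    (1 : PUnit →* Aut X) g = Iso.refl X :=
  rfl

namespace Jacobian

variable {X Y : SchemeOver ℂ}

/-- `Nm_e ≫ Nm_{e⁻¹} = 𝟙` for an isomorphism of curves `e : X ≅ Y` (Albanese functoriality ★ `pushforward_comp`,
★ `pushforward_id`). [cite: Milne1986JacobianVarieties, §6 Prop. 6.4] -/
theorem pushforward_hom_comp_pushforward_inv (𝒥X : Jacobian X) (𝒥Y : Jacobian Y) (e : X ≅ Y) :
    𝒥X.pushforward 𝒥Y e.hom ≫ 𝒥Y.pushforward 𝒥X e.inv = 𝟙 𝒥X.J := by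
  rw [← pushforward_comp, e.hom_inv_id, pushforward_id]

/-- `Nm_{e⁻¹} ≫ Nm_e = 𝟙` for an isomorphism of curves `e : X ≅ Y`. [cite: Milne1986JacobianVarieties, §6 Prop. 6.4] -/
theorem pushforward_inv_comp_pushforward_hom (𝒥X : Jacobian X) (𝒥Y : Jacobian Y) (e : X ≅ Y) :
    𝒥Y.pushforward 𝒥X e.inv ≫ 𝒥X.pushforward 𝒥Y e.hom = 𝟙 𝒥Y.J := by
  rw [← pushforward_comp, e.inv_hom_id, pushforward_id]

/-- `Nm_e : J_X ⟶ J_Y` is an isomorphism of abelian varieties for an isomorphism of curves `e`.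
[cite: Milne1986JacobianVarieties, §6 Prop. 6.4] -/
theorem isIso_pushforward_hom (𝒥X : Jacobian X) (𝒥Y : Jacobian Y) (e : X ≅ Y) : IsIso (𝒥X.pushforward 𝒥Y e.hom) :=
  ⟨𝒥Y.pushforward 𝒥X e.inv, pushforward_hom_comp_pushforward_inv 𝒥X 𝒥Y e,
    pushforward_inv_comp_pushforward_hom 𝒥X 𝒥Y e⟩

/-- The underlying scheme morphism of `Nm_e` is dominant (it has the section `Nm_{e⁻¹}`), so that Cartier divisors on
`J_Y` pull back along it. [cite: Milne1986JacobianVarieties, §6 Prop. 6.4] -/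
theorem isDominant_toSchemeHom_pushforward_hom (𝒥X : Jacobian X) (𝒥Y : Jacobian Y) (e : X ≅ Y) :
    IsDominant (AbelianVariety.Hom.toSchemeHom (𝒥X.pushforward 𝒥Y e.hom)) := by
  haveI : IsDominant (AbelianVariety.Hom.toSchemeHom (𝒥Y.pushforward 𝒥X e.inv) ≫
      AbelianVariety.Hom.toSchemeHom (𝒥X.pushforward 𝒥Y e.hom)) := by
    rw [show AbelianVariety.Hom.toSchemeHom (𝒥Y.pushforward 𝒥X e.inv) ≫
        AbelianVariety.Hom.toSchemeHom (𝒥X.pushforward 𝒥Y e.hom) =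
        AbelianVariety.Hom.toSchemeHom (𝒥Y.pushforward 𝒥X e.inv ≫ 𝒥X.pushforward 𝒥Y e.hom) from rfl,
      pushforward_inv_comp_pushforward_hom]
    exact inferInstanceAs (IsDominant (𝟙 𝒥Y.J.X.left))
  exact IsDominant.of_comp (AbelianVariety.Hom.toSchemeHom (𝒥Y.pushforward 𝒥X e.inv)) _

/-- The Galois pin of the fact at `Δ = 1`: `Nm_e ≫ Nm_{e⁻¹} = Σ_{δ ∈ 1} (act δ)_* ` for the trivial action
`act = 1 : PUnit →* Aut X` ([LangeRodriguez2022] Prop. 3.5.1 «`Nm_G = f^* ∘ Nm_f`» with `G = 1`, `f` an isomorphism: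
`f^* = Nm_f⁻¹`). [cite: LangeRodriguez2022, §3.5.1 Prop. 3.5.1 (p. 65)] -/
theorem pushforward_hom_comp_pushforward_inv_eq_sum (𝒥X : Jacobian X) (𝒥Y : Jacobian Y) (e : X ≅ Y) :
    𝒥X.pushforward 𝒥Y e.hom ≫ 𝒥Y.pushforward 𝒥X e.inv =
      ∑ δ : PUnit.{1}, 𝒥X.pushforward 𝒥X ((1 : PUnit →* Aut X) δ).hom := by
  rw [pushforward_hom_comp_pushforward_inv, Fintype.sum_unique, monoidHom_one_punit_apply_eq_refl, Iso.refl_hom,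
    pushforward_id]

/-! ### §1 `Nm_{e⁻¹}` is the `ē_N`-adjoint of `Nm_e` for the canonical principal polarisations -/

section Adjoint

/-- **`ē_N^{Θ_X}(Nm_{e⁻¹} P, Q) = ē_N^{Θ_Y}(P, Nm_e Q)`** for an isomorphism `e : X ≅ Y` of smooth projective
geometrically irreducible complex curves, Jacobians `𝒥X`, `𝒥Y` with `dim J_Y ≥ 1`, and ANY Riemann theta divisors
`Θ_X`, `Θ_Y` defining the canonical principal polarisations: the named fact ([LangeRodriguez2022] (3.3)
«`\widehat{f^*} = Nm_f`», [Lange2023AbelianVarietiesComplex] (4.9)) at the trivial group `Δ = 1`, `p = e.hom`, where the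
Galois pin `Nm_e ≫ t = 𝟙` forces `t = Nm_{e⁻¹}` (`= e^* = (e⁻¹)_*` on divisor classes).
[cite: LangeRodriguez2022, §3.2.1 eq. (3.3) (pp. 46–47); §3.5.1 Prop. 3.5.1 (p. 65)]
[cite: Lange2023AbelianVarietiesComplex, §4.5.2 eq. (4.9)] -/
theorem weilPairingLevel_pushforward_inv_eq (hFP2 : galoisCover_pullback_isWeilPairingAdjoint_norm)
    (hX : IsSmoothProjective 1 X) (hY : IsSmoothProjective 1 Y)
    (𝒥X : Jacobian X) (𝒥Y : Jacobian Y) (hdim : 1 ≤ 𝒥Y.J.dim) (e : X ≅ Y)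
    {ΘX : CartierDivisor 𝒥X.J.X.left} {ΘY : CartierDivisor 𝒥Y.J.X.left}
    (h1 : 𝒥X.IsRiemannThetaDivisor ΘX) (h2 : 𝒥X.J.IsPrincipalPolarizationDivisor ΘX)
    (h3 : 𝒥Y.IsRiemannThetaDivisor ΘY) (h4 : 𝒥Y.J.IsPrincipalPolarizationDivisor ΘY)
    (N : ℕ) [IsDominant (AbelianVariety.Hom.toSchemeHom ((N : ℤ) • 𝟙 𝒥X.J))]
    [IsDominant (AbelianVariety.Hom.toSchemeHom ((N : ℤ) • 𝟙 𝒥Y.J))]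
    (P : 𝒥Y.J.torsionPoints ℂ N) (Q : 𝒥X.J.torsionPoints ℂ N) :
    𝒥X.J.weilPairingLevel ΘX
        ⟨AlgPoints.map (𝒥Y.pushforward 𝒥X e.inv).hom.hom.hom P.1,
          AbelianVariety.map_mem_torsionPoints (𝒥Y.pushforward 𝒥X e.inv) P.2⟩ Q =
      𝒥Y.J.weilPairingLevel ΘY P
        ⟨AlgPoints.map (𝒥X.pushforward 𝒥Y e.hom).hom.hom.hom Q.1,
          AbelianVariety.map_mem_torsionPoints (𝒥X.pushforward 𝒥Y e.hom) Q.2⟩ :=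
  hFP2 X Y hX hY 𝒥X 𝒥Y hdim PUnit.{1} (1 : PUnit →* Aut X) (Function.injective_of_subsingleton _) e.hom
    (isSepQuotient_of_forall_eq_refl_of_isIso _ (monoidHom_one_punit_apply_eq_refl X) e.hom) ΘX ΘY h1 h2 h3 h4
    (𝒥Y.pushforward 𝒥X e.inv) (pushforward_hom_comp_pushforward_inv_eq_sum 𝒥X 𝒥Y e) N P Q

/-! ### §2 `Nm_e` is an isomorphism of principally polarised abelian varieties at every level -/

/-- **`ē_N^{Θ_Y}(Nm_e P, Nm_e Q) = ē_N^{Θ_X}(P, Q)`**: for an isomorphism of curves `e : X ≅ Y` the induced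
isomorphism `Nm_e : J_X ⥲ J_Y` matches the canonical theta pairings at every level `N`, for ANY Riemann theta divisors
`Θ_X`, `Θ_Y` defining the canonical principal polarisations (§1 at `P := Nm_e P` and `Nm_{e⁻¹} Nm_e = 𝟙`).
[cite: Lange2023AbelianVarietiesComplex, §4.5.2 eq. (4.9)] [cite: LangeRodriguez2022, §3.2.1 eq. (3.3) (pp. 46–47)] -/
theorem weilPairingLevel_pushforward_iso_eq (hFP2 : galoisCover_pullback_isWeilPairingAdjoint_norm)
    (hX : IsSmoothProjective 1 X) (hY : IsSmoothProjective 1 Y)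
    (𝒥X : Jacobian X) (𝒥Y : Jacobian Y) (hdim : 1 ≤ 𝒥Y.J.dim) (e : X ≅ Y)
    {ΘX : CartierDivisor 𝒥X.J.X.left} {ΘY : CartierDivisor 𝒥Y.J.X.left}
    (h1 : 𝒥X.IsRiemannThetaDivisor ΘX) (h2 : 𝒥X.J.IsPrincipalPolarizationDivisor ΘX)
    (h3 : 𝒥Y.IsRiemannThetaDivisor ΘY) (h4 : 𝒥Y.J.IsPrincipalPolarizationDivisor ΘY)
    (N : ℕ) [IsDominant (AbelianVariety.Hom.toSchemeHom ((N : ℤ) • 𝟙 𝒥X.J))]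
    [IsDominant (AbelianVariety.Hom.toSchemeHom ((N : ℤ) • 𝟙 𝒥Y.J))]
    (P Q : 𝒥X.J.torsionPoints ℂ N) :
    𝒥Y.J.weilPairingLevel ΘY
        ⟨AlgPoints.map (𝒥X.pushforward 𝒥Y e.hom).hom.hom.hom P.1,
          AbelianVariety.map_mem_torsionPoints (𝒥X.pushforward 𝒥Y e.hom) P.2⟩
        ⟨AlgPoints.map (𝒥X.pushforward 𝒥Y e.hom).hom.hom.hom Q.1,
          AbelianVariety.map_mem_torsionPoints (𝒥X.pushforward 𝒥Y e.hom) Q.2⟩ =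
      𝒥X.J.weilPairingLevel ΘX P Q := by
  have h := weilPairingLevel_pushforward_inv_eq hFP2 hX hY 𝒥X 𝒥Y hdim e h1 h2 h3 h4 N
    ⟨AlgPoints.map (𝒥X.pushforward 𝒥Y e.hom).hom.hom.hom P.1,
      AbelianVariety.map_mem_torsionPoints (𝒥X.pushforward 𝒥Y e.hom) P.2⟩ Q
  have hP : (⟨AlgPoints.map (𝒥Y.pushforward 𝒥X e.inv).hom.hom.hom
        (AlgPoints.map (𝒥X.pushforward 𝒥Y e.hom).hom.hom.hom P.1),
      AbelianVariety.map_mem_torsionPoints (𝒥Y.pushforward 𝒥X e.inv)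
        (AbelianVariety.map_mem_torsionPoints (𝒥X.pushforward 𝒥Y e.hom) P.2)⟩ : 𝒥X.J.torsionPoints ℂ N) = P := by
    apply Subtype.ext
    change (P.1 ≫ (𝒥X.pushforward 𝒥Y e.hom).hom.hom.hom) ≫ (𝒥Y.pushforward 𝒥X e.inv).hom.hom.hom = P.1
    rw [Category.assoc, show (𝒥X.pushforward 𝒥Y e.hom).hom.hom.hom ≫ (𝒥Y.pushforward 𝒥X e.inv).hom.hom.hom =
      (𝒥X.pushforward 𝒥Y e.hom ≫ 𝒥Y.pushforward 𝒥X e.inv).hom.hom.hom from rfl, pushforward_hom_comp_pushforward_inv]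
    exact Category.comp_id _
  rw [hP] at h
  exact h.symm

/-- **Pull-back form `ē_N^{(Nm_e)^*Θ_Y}(P, Q) = ē_N^{Θ_X}(P, Q)`**: the pull-back of a canonical theta pairing of
`J_Y` along `Nm_e` IS the canonical theta pairing of `J_X` (★ `AbelianVariety.weilPairingLevel_pullback` + §2); the
dominance of `Nm_e` needed to form the pull-back divisor is `isDominant_toSchemeHom_pushforward_hom`, carried as an
instance binder. [cite: Lange2023AbelianVarietiesComplex, §4.5.2 eq. (4.9)] [cite: MumfordAV1970, §20 (property (3) of e_n, p. 186)] -/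
theorem weilPairingLevel_pullback_pushforward_iso_eq (hFP2 : galoisCover_pullback_isWeilPairingAdjoint_norm)
    (hX : IsSmoothProjective 1 X) (hY : IsSmoothProjective 1 Y)
    (𝒥X : Jacobian X) (𝒥Y : Jacobian Y) (hdim : 1 ≤ 𝒥Y.J.dim) (e : X ≅ Y)
    {ΘX : CartierDivisor 𝒥X.J.X.left} {ΘY : CartierDivisor 𝒥Y.J.X.left}
    (h1 : 𝒥X.IsRiemannThetaDivisor ΘX) (h2 : 𝒥X.J.IsPrincipalPolarizationDivisor ΘX)
    (h3 : 𝒥Y.IsRiemannThetaDivisor ΘY) (h4 : 𝒥Y.J.IsPrincipalPolarizationDivisor ΘY)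
    [IsDominant (AbelianVariety.Hom.toSchemeHom (𝒥X.pushforward 𝒥Y e.hom))]
    (N : ℕ) [IsDominant (AbelianVariety.Hom.toSchemeHom ((N : ℤ) • 𝟙 𝒥X.J))]
    [IsDominant (AbelianVariety.Hom.toSchemeHom ((N : ℤ) • 𝟙 𝒥Y.J))]
    (P Q : 𝒥X.J.torsionPoints ℂ N) :
    𝒥X.J.weilPairingLevel (ΘY.pullback (AbelianVariety.Hom.toSchemeHom (𝒥X.pushforward 𝒥Y e.hom))) P Q =
      𝒥X.J.weilPairingLevel ΘX P Q := by
  rw [AbelianVariety.weilPairingLevel_pullback (𝒥X.pushforward 𝒥Y e.hom) ΘY P Q]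
  exact weilPairingLevel_pushforward_iso_eq hFP2 hX hY 𝒥X 𝒥Y hdim e h1 h2 h3 h4 N P Q

/-! ### §3 (Θ-uniq): the canonical theta pairing does not depend on the theta divisor -/

/-- **(Θ-uniq) `ē_N^{Θ}(P, Q) = ē_N^{Θ′}(P, Q)`** for two Riemann theta divisors `Θ`, `Θ′` of ONE Jacobian `𝒥` (of a
smooth projective geometrically irreducible complex curve, `dim J ≥ 1`) which both define PRINCIPAL polarisations: the
canonical polarisation of `J` is well defined whichever theta divisor represents it — every theta divisor is a translate of
`W̃_{g−1}` and all of them define one polarisation ([Lange2023AbelianVarietiesComplex] §4.1.2 Prop. 4.1.2, §4.2.1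
Cor. 4.2.4).  This is the fact at `X = Y`, `p = 𝟙`, `Δ = 1`, `t = 𝟙` (its disclosed trivial-cover content).
[cite: Lange2023AbelianVarietiesComplex, §4.1.2 Prop. 4.1.2 and §4.2.1 Cor. 4.2.4]
[cite: LangeRodriguez2022, §3.2.1 eq. (3.3) (pp. 46–47)] -/
theorem weilPairingLevel_eq_of_isRiemannThetaDivisor (hFP2 : galoisCover_pullback_isWeilPairingAdjoint_norm)
    (hX : IsSmoothProjective 1 X) (𝒥 : Jacobian X)
    (hdim : 1 ≤ 𝒥.J.dim) {Θ Θ' : CartierDivisor 𝒥.J.X.left}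
    (h1 : 𝒥.IsRiemannThetaDivisor Θ) (h2 : 𝒥.J.IsPrincipalPolarizationDivisor Θ)
    (h3 : 𝒥.IsRiemannThetaDivisor Θ') (h4 : 𝒥.J.IsPrincipalPolarizationDivisor Θ')
    (N : ℕ) [IsDominant (AbelianVariety.Hom.toSchemeHom ((N : ℤ) • 𝟙 𝒥.J))] (P Q : 𝒥.J.torsionPoints ℂ N) :
    𝒥.J.weilPairingLevel Θ P Q = 𝒥.J.weilPairingLevel Θ' P Q := by
  have h := weilPairingLevel_pushforward_iso_eq hFP2 hX hX 𝒥 𝒥 hdim (Iso.refl X) h1 h2 h3 h4 N P Q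
  have hP : ∀ R : 𝒥.J.torsionPoints ℂ N,
      (⟨AlgPoints.map (𝒥.pushforward 𝒥 (Iso.refl X).hom).hom.hom.hom R.1,
        AbelianVariety.map_mem_torsionPoints (𝒥.pushforward 𝒥 (Iso.refl X).hom) R.2⟩ : 𝒥.J.torsionPoints ℂ N) = R := by
    intro R
    apply Subtype.ext
    change R.1 ≫ (𝒥.pushforward 𝒥 (𝟙 X)).hom.hom.hom = R.1
    rw [pushforward_id]
    exact Category.comp_id _
  rw [hP P, hP Q] at h
  exact h.symm

/-! ### §4 Two Jacobian structures of one curve -/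

/-- **Two Jacobians of one curve have matching canonical theta pairings under their canonical isomorphism**: for Jacobian
structures `𝒥₁`, `𝒥₂` of the same curve `X` (uniquely isomorphic, `uniqueUpToIso 𝒥₁ 𝒥₂ = Nm_{𝟙}`,
★ `pushforward_id_eq_uniqueUpToIso_hom`; [Milne1986JacobianVarieties] Remark 6.5) and principal Riemann theta divisors
`Θ₁` on `J₁`, `Θ₂` on `J₂`: `ē_N^{Θ₂}(u P, u Q) = ē_N^{Θ₁}(P, Q)` with `u = uniqueUpToIso 𝒥₁ 𝒥₂`.
[cite: Milne1986JacobianVarieties, §6 Prop. 6.4 and Remark 6.5] [cite: Lange2023AbelianVarietiesComplex, §4.5.2 eq. (4.9)] -/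
theorem weilPairingLevel_uniqueUpToIso_eq (hFP2 : galoisCover_pullback_isWeilPairingAdjoint_norm)
    (hX : IsSmoothProjective 1 X) (𝒥₁ 𝒥₂ : Jacobian X) (hdim : 1 ≤ 𝒥₂.J.dim)
    {Θ₁ : CartierDivisor 𝒥₁.J.X.left} {Θ₂ : CartierDivisor 𝒥₂.J.X.left}
    (h1 : 𝒥₁.IsRiemannThetaDivisor Θ₁) (h2 : 𝒥₁.J.IsPrincipalPolarizationDivisor Θ₁)
    (h3 : 𝒥₂.IsRiemannThetaDivisor Θ₂) (h4 : 𝒥₂.J.IsPrincipalPolarizationDivisor Θ₂)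
    (N : ℕ) [IsDominant (AbelianVariety.Hom.toSchemeHom ((N : ℤ) • 𝟙 𝒥₁.J))]
    [IsDominant (AbelianVariety.Hom.toSchemeHom ((N : ℤ) • 𝟙 𝒥₂.J))] (P Q : 𝒥₁.J.torsionPoints ℂ N) :
    𝒥₂.J.weilPairingLevel Θ₂
        ⟨AlgPoints.map (uniqueUpToIso 𝒥₁ 𝒥₂).hom.hom.hom.hom P.1,
          AbelianVariety.map_mem_torsionPoints (uniqueUpToIso 𝒥₁ 𝒥₂).hom P.2⟩
        ⟨AlgPoints.map (uniqueUpToIso 𝒥₁ 𝒥₂).hom.hom.hom.hom Q.1,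
          AbelianVariety.map_mem_torsionPoints (uniqueUpToIso 𝒥₁ 𝒥₂).hom Q.2⟩ =
      𝒥₁.J.weilPairingLevel Θ₁ P Q := by
  have h := weilPairingLevel_pushforward_iso_eq hFP2 hX hX 𝒥₁ 𝒥₂ hdim (Iso.refl X) h1 h2 h3 h4 N P Q
  have hP : ∀ R : 𝒥₁.J.torsionPoints ℂ N,
      (⟨AlgPoints.map (𝒥₁.pushforward 𝒥₂ (Iso.refl X).hom).hom.hom.hom R.1,
        AbelianVariety.map_mem_torsionPoints (𝒥₁.pushforward 𝒥₂ (Iso.refl X).hom) R.2⟩ : 𝒥₂.J.torsionPoints ℂ N) =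
        ⟨AlgPoints.map (uniqueUpToIso 𝒥₁ 𝒥₂).hom.hom.hom.hom R.1,
          AbelianVariety.map_mem_torsionPoints (uniqueUpToIso 𝒥₁ 𝒥₂).hom R.2⟩ := by
    intro R
    apply Subtype.ext
    change AlgPoints.map (𝒥₁.pushforward 𝒥₂ (𝟙 X)).hom.hom.hom R.1 = _
    rw [pushforward_id_eq_uniqueUpToIso_hom]
  rw [hP P, hP Q] at h
  exact h

end Adjoint

end Jacobian

end Literature.AlgebraicGeometry.Motives

end
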